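import Summits.AtomisticToContinuum.HydrodynamicLimit.Theses.AntiMazurCoboundaries
import Summits.AtomisticToContinuum.HydrodynamicLimit.Theses.FluxGibbsianityLdDrude
import Summits.AtomisticToContinuum.HydrodynamicLimit.Theorems.JParityClosureOddContactSymmetryGibbsInvariance
import Literature.MathematicalPhysics.KineticTheory.HardSphereWindowPressureStatic
import Literature.Analysis.FluidPDE.HardSphereFlowJointMeasurable
import Literature.Analysis.UnboundedOperators.LinearizedBoltzmannGainForms
import HarnessLib

/-!
# Objects of the crux line `h-theorem-dissipation-budget` (crux `KineticFluxLdDecay`,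
# stmt-AtomisticToContinuum-10967; routes AntiMazurCoboundaries r4 / FluxGibbsianityLdDrude r2)

Objects module of the line skeleton `Cruxes/KineticFluxLdDecay/Lines/h_theorem_dissipation_budget.lean`
(idea card `Cruxes/KineticFluxLdDecay/Ideas/h-theorem-dissipation-budget.md`, crux-ideate round 2): the frame
abbreviations (matching the crux decl by unfolding), the REDUCED ONE-BODY LAW of an `N`-body law along a
hard-sphere flow (`oneBodyLaw`, coordinates `(x, w)`, `w = (v − u₀)/√θ`, reference `m = vol ⊗ γ`), its
velocity relative entropy `velKL f = KL(f ‖ f₁ ⊗ γ)`, the HELLINGER ENTROPY PRODUCTION `production ρ` of a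
one-body density (collision weight `B M M_*` of the tree's `collisionDensity`, defect
`√(ρ'ρ'_*) − √(ρρ_*)`), the statements of the five registered stubs, and a small junk-free API — in ONE
importable `Theorems` module shared by the stub helper files (`--supports stmt-AtomisticToContinuum-10967`)
and the closing file.

The line (H-theorem as the rate mechanism; Donsker–Varadhan at finite `N`):
`log E_G e^X = E_{G^X} X − KL(G^X ‖ G)` for the window average `X = h⁻¹∫₀ʰ F∘Φ_t dt` (`WindowDuality`);
`E_ν F∘Φ_t = (N+1) ∫ φ⊗g df_t` (`OneBodyMarginal`); `∫ φ⊗g df ≤ C √(production) + ½ velKL f`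
(`GainDomination`, the kinetic lemma: weak formulation against the landed quartic-growth Chapman–Enskog
inverse `L⁻¹g`); `(N+1) velKL f_t ≤ KL(ν ‖ G)` (`VelocityEntropyBudget`); and the bet
`NoPerpetualDissipation` (time-integrated Hellinger production of the one-body law ≤ `(A·s + B)/τ` per unit
kinetic time). AM–GM in `√·` and the choice `τ(δ)` close the crux (skeleton file).

Design: all expectations against laws carried by `Φ.good`; productions are `∫⁻` (no measurability or
finiteness claims hidden in a Bochner junk value); densities are THE Radon–Nikodym derivatives w.r.t.
`m = vol ⊗ γ` (`oneBodyDensity`), so the stubs interlock definitionally.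
-/

noncomputable section

open MeasureTheory ProbabilityTheory Set Filter InformationTheory
open scoped ENNReal

namespace Summit.AtomisticToContinuum.HydrodynamicLimit.Theorems.HTheorem

open Literature.MathematicalPhysics.KineticTheory (T3 V3 hsDiameter localGibbsLaw collide sphereMeasure)
open Literature.Analysis.FluidPDE (HardSphereFlow Config)
open Literature.Analysis.UnboundedOperators (collisionDensity)

/-! ## Frame abbreviations (reducible; the crux decls are matched by unfolding) -/

/-- Hard-sphere flows of `n` spheres of diameter `ε` on `𝕋³`. -/
abbrev TFlow (ε : ℝ) (n : ℕ) : Type :=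
  HardSphereFlow (Literature.Analysis.FluidPDE.Torus.geometry (Fin 3)) ε n

/-- Phase space of `n` spheres on `𝕋³`. -/
abbrev TPhase (n : ℕ) : Type := Config n (Fin 3) T3

/-- The crux's flows: `N + 1` spheres of diameter `σ (N+1)^{-1/3}`. -/
abbrev Flow (σ : ℝ) (N : ℕ) : Type := TFlow (hsDiameter σ N) (N + 1)

/-- The crux's phase space. -/
abbrev Phase (N : ℕ) : Type := TPhase (N + 1)

/-- The flow-invariant global Gibbs law `G_N` of the crux (constant profiles `a, u₀, θ`). -/
abbrev gibbs (σ a θ : ℝ) (u₀ : V3) (N : ℕ) (Φ : Flow σ N) : Measure (Phase N) :=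
  localGibbsLaw σ (fun _ => a) (fun _ => u₀) (fun _ => θ) N Φ

/-- The fast one-body observable `F(z) = Σᵢ φ(xᵢ) g((vᵢ − u₀)/√θ)` of the crux. -/
abbrev fluxObs (θ : ℝ) (u₀ : V3) (φ : T3 → ℝ) (g : V3 → ℝ) (N : ℕ) (z : Phase N) : ℝ :=
  ∑ i, φ (z i).1 * g ((Real.sqrt θ)⁻¹ • ((z i).2 - u₀))

/-- The kinetic window `h = τ (N+1)^{-1/3}`. -/
abbrev window (τ : ℝ) (N : ℕ) : ℝ := τ * ((N + 1 : ℕ) : ℝ) ^ (-(1 / 3 : ℝ))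

/-- The crux's orthogonality clause `g ⊥ span{1, v, |v|²}` in `L²(stdGaussian ℝ³)`. -/
abbrev Orthogonal (g : V3 → ℝ) : Prop :=
  ∀ (c₀ c₂ : ℝ) (b : V3),
    ∫ v, g v * (c₀ + inner ℝ b v + c₂ * ‖v‖ ^ 2) ∂(ProbabilityTheory.stdGaussian V3) = 0

section Window

variable {ε : ℝ} {n : ℕ}

/-- Path integral of an observable along the orbit over the forward window: `J_u(z) = ∫₀ᵘ F(Φ_r z) dr`. -/
abbrev pathInt (Φ : TFlow ε n) (F : TPhase n → ℝ) (u : ℝ) (z : TPhase n) : ℝ :=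
  ∫ r in (0 : ℝ)..u, F (Φ.flow r z)

/-- The WINDOW AVERAGE `X = h⁻¹ J_h` (the exponent of the crux's LD functional). -/
abbrev windowAvg (Φ : TFlow ε n) (F : TPhase n → ℝ) (h : ℝ) (z : TPhase n) : ℝ :=
  h⁻¹ * pathInt Φ F h z

end Window

/-! ## Reduced one-body objects -/

/-- Reduced one-body coordinates of particle `i`: `(xᵢ, wᵢ)` with `w = (v − u₀)/√θ`. -/
def reducedCoord (θ : ℝ) (u₀ : V3) (n : ℕ) (i : Fin n) (z : TPhase n) : T3 × V3 :=
  ((z i).1, (Real.sqrt θ)⁻¹ • ((z i).2 - u₀))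

/-- The REDUCED ONE-BODY LAW at time `t` of an `n`-body law `ν` along the flow `Φ`:
`f_t = n⁻¹ Σᵢ Law_ν (xᵢ(t), wᵢ(t))`, a measure on `𝕋³ × ℝ³` (a probability measure when `ν` is). -/
def oneBodyLaw {ε : ℝ} {n : ℕ} (θ : ℝ) (u₀ : V3) (Φ : TFlow ε n) (ν : Measure (TPhase n)) (t : ℝ) :
    Measure (T3 × V3) :=
  ((n : ℝ≥0∞)⁻¹) • ∑ i : Fin n, ν.map (fun z => reducedCoord θ u₀ n i (Φ.flow t z))

/-- The reference one-body measure `m = vol_{𝕋³} ⊗ γ` (`γ` the standard Gaussian): the reduced one-body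
law of the global Gibbs law itself. -/
def refMeasure : Measure (T3 × V3) := (volume : Measure T3).prod (stdGaussian V3)

/-- The ONE-BODY DENSITY (Radon–Nikodym derivative of the reduced one-body law w.r.t. `m = vol ⊗ γ`; the
Maxwellian equilibrium is `ρ ≡ 1`). -/
def oneBodyDensity {ε : ℝ} {n : ℕ} (θ : ℝ) (u₀ : V3) (Φ : TFlow ε n) (ν : Measure (TPhase n))
    (t : ℝ) : T3 × V3 → ℝ :=
  fun y => ((oneBodyLaw θ u₀ Φ ν t).rnDeriv refMeasure y).toReal

/-- The VELOCITY RELATIVE ENTROPY of a one-body law: `KL(f ‖ f₁ ⊗ γ)` with `f₁` the position marginal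
(`= ∫ n(x) KL(f(x, ·)/n(x) ‖ γ) dx` for `f = ρ · m`). -/
def velKL (f : Measure (T3 × V3)) : ℝ≥0∞ := klDiv f (f.fst.prod (stdGaussian V3))

/-! ## Hellinger entropy production -/

/-- Collision space `(v, v_*, ω)`. -/
abbrev CollSpace : Type := (V3 × V3) × Metric.sphere (0 : V3) 1

/-- The measure `dv dv_* dω` on collision space (the tree's `collisionDensity = B M M_*` is the weight). -/
def collMeasure : Measure CollSpace := ((volume : Measure V3).prod volume).prod sphereMeasure

/-- The HELLINGER DEFECT of a velocity density `r` (w.r.t. `γ`) at a collision: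
`Ξ(r)(v, v_*, ω) = √r(v') √r(v'_*) − √r(v) √r(v_*)`; it vanishes identically iff `r γ` is a Maxwellian. -/
def hellingerDefect (r : V3 → ℝ) (q : CollSpace) : ℝ :=
  Real.sqrt (r (collide q.2 q.1).1) * Real.sqrt (r (collide q.2 q.1).2) -
    Real.sqrt (r q.1.1) * Real.sqrt (r q.1.2)

/-- The HELLINGER ENTROPY PRODUCTION of a one-body density `ρ` on `𝕋³ × ℝ³` (density w.r.t. `vol ⊗ γ`):
`𝒟(ρ) = ∫ dx ∫ B M M_* (√(ρ'ρ'_*) − √(ρρ_*))² dv dv_* dω ∈ [0, ∞]` (reduced units). It is `≤` Boltzmann's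
entropy production, quadratic in the local density, and `0` exactly on local Maxwellians. -/
def production (ρ : T3 × V3 → ℝ) : ℝ≥0∞ :=
  ∫⁻ x, ∫⁻ q, ENNReal.ofReal (collisionDensity q * hellingerDefect (fun w => ρ (x, w)) q ^ 2)
    ∂collMeasure ∂(volume : Measure T3)

/-! ## Statements of the registered stubs -/

/-- Statement of `stub_windowDuality` — **Gibbs variational identity + Fubini for the window average**
(abstract frame: any flow on `𝕋³`, any probability law `μ` carried by the good set, any bounded measurable
`F`, any window `h > 0`). With `X = h⁻¹ ∫₀ʰ F∘Φ_t dt` and the tilted law `μ^X = e^X μ / E_μ e^X`: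
`μ^X` is a probability law, `μ^X ≪ μ`, `KL(μ^X ‖ μ) < ∞`, `E_μ e^X = exp(E_{μ^X} X − KL(μ^X ‖ μ))`
(Mathlib `Measure.tilted`; tree `…LedgerAssemblyDuality.klDiv_tilted_eq`), the time-`t` means
`t ↦ E_{μ^X} F∘Φ_t` are integrable on the window and `E_{μ^X} X = h⁻¹ ∫₀ʰ E_{μ^X} F∘Φ_t dt` (Fubini; the
flow is jointly measurable on `good × ℝ`, `HardSphereFlow.measurable_flow_prod_torus`). -/
def WindowDuality : Prop :=
  ∀ (ε : ℝ) (n : ℕ) (Φ : TFlow ε n) (μ : Measure (TPhase n)), IsProbabilityMeasure μ →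
    μ Φ.goodᶜ = 0 → ∀ F : TPhase n → ℝ, Measurable F → (∃ C : ℝ, ∀ z, |F z| ≤ C) →
    ∀ h : ℝ, 0 < h →
      IsProbabilityMeasure (μ.tilted (windowAvg Φ F h)) ∧
      μ.tilted (windowAvg Φ F h) ≪ μ ∧
      klDiv (μ.tilted (windowAvg Φ F h)) μ ≠ ⊤ ∧
      ∫⁻ z, ENNReal.ofReal (Real.exp (windowAvg Φ F h z)) ∂μ =
        ENNReal.ofReal (Real.exp ((∫ z, windowAvg Φ F h z ∂(μ.tilted (windowAvg Φ F h))) -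
          (klDiv (μ.tilted (windowAvg Φ F h)) μ).toReal)) ∧
      IntervalIntegrable (fun t => ∫ z, F (Φ.flow t z) ∂(μ.tilted (windowAvg Φ F h))) volume 0 h ∧
      ∫ z, windowAvg Φ F h z ∂(μ.tilted (windowAvg Φ F h)) =
        h⁻¹ * ∫ t in (0 : ℝ)..h, ∫ z, F (Φ.flow t z) ∂(μ.tilted (windowAvg Φ F h))

/-- Statement of `stub_oneBodyMarginal` — **the reduced one-body law and the gain identity** (crux frame;
`θ > 0`; `ν` a probability law with `ν ≪ G_N`): for every time `t` the reduced one-body law `f_t` of `ν` is a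
probability law, absolutely continuous w.r.t. `m = vol ⊗ γ` (invariance of `G_N` under `Φ_t`,
`Theorems.measurePreserving_flow_localGibbsLaw_const`; the one-particle marginal of `G_N ≪ Liouville` in
reduced coordinates is `≪ vol ⊗ γ`), and for bounded measurable `φ, g`,
`E_ν[F∘Φ_t] = (N+1) ∫ φ(x) g(w) df_t(x, w)` (change of variables under `Measure.map`). -/
def OneBodyMarginal : Prop :=
  ∀ (σ a θ : ℝ) (u₀ : V3) (N : ℕ) (Φ : Flow σ N) (ν : Measure (Phase N)), IsProbabilityMeasure ν →
    0 < θ → ν ≪ gibbs σ a θ u₀ N Φ → ∀ t : ℝ,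
      IsProbabilityMeasure (oneBodyLaw θ u₀ Φ ν t) ∧
      oneBodyLaw θ u₀ Φ ν t ≪ refMeasure ∧
      ∀ (φ : T3 → ℝ) (g : V3 → ℝ), Measurable φ → Measurable g →
        (∃ C : ℝ, ∀ x, |φ x| ≤ C) → (∃ C : ℝ, ∀ w, |g w| ≤ C) →
        ∫ z, fluxObs θ u₀ φ g N (Φ.flow t z) ∂ν =
          ((N + 1 : ℕ) : ℝ) * ∫ y, φ y.1 * g y.2 ∂(oneBodyLaw θ u₀ Φ ν t)

/-- Statement of `stub_velocityEntropyBudget` — **the velocity entropies of the one-body law are budgeted by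
the `N`-body relative entropy**: in the crux frame (`a, θ > 0`, `σ ≤ 1/2`), for a probability law `ν ≪ G_N`
with `KL(ν ‖ G_N) < ∞` and every time `t`, `(N+1) · KL(f_t ‖ (f_t)₁ ⊗ γ) ≤ KL(ν ‖ G_N)` (finite).
Proof plan: Donsker–Varadhan `E_ν Y ≤ KL(ν‖G) + log E_G e^Y` (tree
`…LedgerAssemblyDuality.integral_le_klDiv_add_log`) with `Y = Σᵢ ψ(xᵢ(t), wᵢ(t))` for velocity-normalised
one-body test functions `ψ` (`∫ e^{ψ(x, w)} γ(dw) ≤ 1`); `E_G e^Y ≤ 1` by invariance of `G_N` and the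
Gaussian one-site factorisation (`lintegral_exp_sum_localGibbsMeasure_const_le`,
`lintegral_gaussMeasure_eq_lintegral_stdGaussian_sv`); `ψ ↑ log(df_t/d((f_t)₁ ⊗ γ))` (truncations). -/
def VelocityEntropyBudget : Prop :=
  ∀ (σ a θ : ℝ) (u₀ : V3) (N : ℕ) (Φ : Flow σ N) (ν : Measure (Phase N)), IsProbabilityMeasure ν →
    0 < a → 0 < θ → σ ≤ 1 / 2 →
    ν ≪ gibbs σ a θ u₀ N Φ → klDiv ν (gibbs σ a θ u₀ N Φ) ≠ ⊤ → ∀ t : ℝ,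
      velKL (oneBodyLaw θ u₀ Φ ν t) ≠ ⊤ ∧
      ((N + 1 : ℕ) : ℝ) * (velKL (oneBodyLaw θ u₀ Φ ν t)).toReal ≤
        (klDiv ν (gibbs σ a θ u₀ N Φ)).toReal

/-- Statement of `stub_gainDomination` — **GAIN–DISSIPATION DUALITY, nonlinear** (pure kinetic theory, the
line's first lemma in the form the composition consumes): there is an absolute amplitude `κ₁ > 0` such that
for every continuous `|g| ≤ κ₁` with `g ⊥ span{1, v, |v|²}` there is `C ≥ 0` with, for all measurable
`|φ| ≤ 1` and every one-body probability law `f ≪ vol ⊗ γ` of finite velocity entropy and Hellinger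
production `≤ d`: `∫ φ(x) g(w) df ≤ C √d + ½ KL(f ‖ f₁ ⊗ γ)`.
Proof plan (weak formulation; no local-equilibrium case analysis): `ψ := L⁻¹g` continuous with
`|ψ(v)| ≤ C_K κ₁ (1+|v|²)²` (`exists_continuous_inverse_hardSphereLinearizedOp_quartic`, via `orthogonal_iff`);
per fibre `x`, with `ρ = df/dm`, `n = ∫ ρ dγ`, `ζ = √ρ − √n`: `∫ g ρ dγ = 2√n ⟨g, ζ⟩_γ + ⟨g, ζ²⟩_γ`
(`∫ g dγ = 0`), `4⟨g, ζ⟩_γ = −∫ B M M_* (Tψ)(Tζ)` (`T u = u' + u'_* − u − u_*`; symmetrisation by the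
tree's measure-preserving involutions of `collisionDensity`), `√n Tζ = Ξ − (ζ'ζ'_* − ζζ_*)` with `Ξ` the
Hellinger defect; Cauchy–Schwarz gives `½ ‖Tψ‖_B ‖Ξ_x‖_B`, Gaussian moments give
`|∫ B M M_* Tψ (ζ'ζ'_* − ζζ_*)| ≤ 2 K_ψ ‖ζ_x‖²_γ`; integrate in `x` (Jensen for `√`, `vol 𝕋³ = 1`) and use
`∫∫ ζ² = 2 H²(f, f₁ ⊗ γ) ≤ KL`; `κ₁` makes `(K_ψ + κ₁) ≤ ½`. -/
def GainDomination : Prop :=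
  ∃ κ₁ : ℝ, 0 < κ₁ ∧ ∀ g : V3 → ℝ, Continuous g → (∀ w, |g w| ≤ κ₁) → Orthogonal g →
    ∃ C : ℝ, 0 ≤ C ∧ ∀ φ : T3 → ℝ, Measurable φ → (∀ x, |φ x| ≤ 1) →
      ∀ f : Measure (T3 × V3), IsProbabilityMeasure f → f ≪ refMeasure → velKL f ≠ ⊤ →
        ∀ d : ℝ, 0 ≤ d → production (fun y => (f.rnDeriv refMeasure y).toReal) ≤ ENNReal.ofReal d →
          ∫ y, φ y.1 * g y.2 ∂f ≤ C * Real.sqrt d + 2⁻¹ * (velKL f).toReal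

/-- Statement of `stub_noPerpetualDissipation` — **`C⁺` = NO PERPETUAL DISSIPATION (the bet; the one
deterministic, `N`-uniform stub of the line).** For constant profiles `(a, θ, u₀)` and small reduced density
`σ < σ₀` there are constants `A, B ≥ 0` such that for every kinetic window `τ`, all large `N`, every flow and
EVERY initial probability law `ν ≪ G_N` of finite relative entropy, the time-integrated Hellinger entropy
production of the reduced one-body law along the `N`-body flow over the window `h = τ(N+1)^{-1/3}` is
budgeted by the `N`-body entropy per particle `s = KL(ν ‖ G_N)/(N+1)`:
`∫₀ʰ 𝒟(ρ_t^ν) dt ≤ (h/τ)(A s + B)`, i.e. time-averaged production `≤ (A s + B)/τ`.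
True with `B = 0` along the Boltzmann flow (H-theorem); true with a sharp constant in every reversible Markov
caricature (time reversal); its negation is a perpetual anti-dissipation machine at fixed specific entropy. -/
def NoPerpetualDissipation : Prop :=
  ∀ (a θ : ℝ) (u₀ : V3), 0 < a → 0 < θ → ∃ σ₀ : ℝ, 0 < σ₀ ∧ ∀ σ : ℝ, 0 < σ → σ < σ₀ →
    ∃ A B : ℝ, 0 ≤ A ∧ 0 ≤ B ∧ ∀ τ : ℝ, 0 < τ → ∃ N₀ : ℕ, ∀ N : ℕ, N₀ ≤ N →
      ∀ (Φ : Flow σ N) (ν : Measure (Phase N)), IsProbabilityMeasure ν →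
        ν ≪ gibbs σ a θ u₀ N Φ → klDiv ν (gibbs σ a θ u₀ N Φ) ≠ ⊤ →
        ∫⁻ t in Set.Ioo 0 (window τ N), production (oneBodyDensity θ u₀ Φ ν t) ≤
          ENNReal.ofReal (window τ N / τ *
            (A * (klDiv ν (gibbs σ a θ u₀ N Φ)).toReal / ((N + 1 : ℕ) : ℝ) + B))

/-! ## Basic API (junk-free facts shared by the stub files)

Frame facts already landed elsewhere (dedup; they apply to the abbreviations above by unfolding):
flow-invariance of `G_N` is `Theorems.measurePreserving_flow_localGibbsLaw_const` (also
`Theorems.SelfTilt.gibbs_invariant`); `G_N` is carried by the good set: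
`Theorems.InfluenceLocality.Negative.gibbs_compl_good`, or inline
`gibbs_absolutelyContinuous … Φ.measure_compl_good`; positivity of the window: `Theorems.DynkinAzuma.window_pos`
(inline `mul_pos hτ (Real.rpow_pos_of_pos _ _)`); `Theorems.SelfTilt.abs_pathInt_le`,
`Theorems.SelfTilt.aemeasurable_pathInt`. -/

/-- The global Gibbs law is absolutely continuous w.r.t. the Liouville measure. -/
theorem gibbs_absolutelyContinuous (σ a θ : ℝ) (u₀ : V3) (N : ℕ) (Φ : Flow σ N) :
    gibbs σ a θ u₀ N Φ ≪ Literature.Analysis.FluidPDE.liouville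
      (Literature.Analysis.FluidPDE.Torus.geometry (Fin 3)) (N + 1) (hsDiameter σ N) :=
  withDensity_absolutelyContinuous _ _

/-- The global Gibbs law is a probability law for `a, θ > 0` and `σ ≤ 1/2`. -/
theorem isProbabilityMeasure_gibbs {σ a θ : ℝ} (ha : 0 < a) (hθ : 0 < θ) (hσ : σ ≤ 1 / 2) (u₀ : V3)
    (N : ℕ) (Φ : Flow σ N) : IsProbabilityMeasure (gibbs σ a θ u₀ N Φ) :=
  Literature.MathematicalPhysics.KineticTheory.isProbabilityMeasure_localGibbsLaw continuous_const
    continuous_const continuous_const (fun _ => ha) (fun _ => hθ) hσ N Φ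

/-- The flux observable of continuous `φ, g` is continuous. -/
theorem continuous_fluxObs (θ : ℝ) (u₀ : V3) {φ : T3 → ℝ} {g : V3 → ℝ} (hφ : Continuous φ)
    (hg : Continuous g) (N : ℕ) : Continuous (fluxObs θ u₀ φ g N) := by
  unfold fluxObs
  fun_prop

/-- The flux observable of measurable `φ, g` is measurable. -/
theorem measurable_fluxObs (θ : ℝ) (u₀ : V3) {φ : T3 → ℝ} {g : V3 → ℝ} (hφ : Measurable φ)
    (hg : Measurable g) (N : ℕ) : Measurable (fluxObs θ u₀ φ g N) := by
  unfold fluxObs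
  refine Finset.measurable_sum _ fun i _ => ?_
  exact (hφ.comp ((measurable_pi_apply i).fst)).mul
    (hg.comp ((measurable_const_smul _).comp ((measurable_pi_apply i).snd.sub_const u₀)))

/-- `|F| ≤ (N+1) κ` when `|φ| ≤ 1` and `|g| ≤ κ`. -/
theorem abs_fluxObs_le (θ : ℝ) (u₀ : V3) {φ : T3 → ℝ} {g : V3 → ℝ} {κ : ℝ} (hφ : ∀ x, |φ x| ≤ 1)
    (hg : ∀ w, |g w| ≤ κ) (N : ℕ) (z : Phase N) :
    |fluxObs θ u₀ φ g N z| ≤ ((N + 1 : ℕ) : ℝ) * κ := by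
  unfold fluxObs
  refine (Finset.abs_sum_le_sum_abs _ _).trans ?_
  have hκ : 0 ≤ κ := (abs_nonneg _).trans (hg 0)
  calc ∑ i, |φ (z i).1 * g ((Real.sqrt θ)⁻¹ • ((z i).2 - u₀))|
      ≤ ∑ _i : Fin (N + 1), κ := Finset.sum_le_sum fun i _ => by
        rw [abs_mul]
        exact (mul_le_mul (hφ _) (hg _) (abs_nonneg _) zero_le_one).trans_eq (one_mul κ)
    _ = ((N + 1 : ℕ) : ℝ) * κ := by simp

/-- `h / τ = (N+1)^{-1/3}`. -/
theorem window_div (τ : ℝ) (hτ : τ ≠ 0) (N : ℕ) :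
    window τ N / τ = ((N + 1 : ℕ) : ℝ) ^ (-(1 / 3 : ℝ)) := by
  unfold window
  field_simp

section WindowAPI

variable {ε : ℝ} {n : ℕ}

/-- The window average of a bounded observable is bounded by the same constant (`h > 0`; at a point
where the orbit section is not integrable the interval integral is the Bochner junk value `0`).
(The path-integral bound itself is the tree's `Theorems.SelfTilt.abs_pathInt_le`.) -/
theorem abs_windowAvg_le (Φ : TFlow ε n) {F : TPhase n → ℝ} {C : ℝ} (hC : ∀ z, |F z| ≤ C) {h : ℝ}
    (hh : 0 < h) (z : TPhase n) : |windowAvg Φ F h z| ≤ C := by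
  have hJ : |pathInt Φ F h z| ≤ |h| * C := by
    have h1 := intervalIntegral.norm_integral_le_of_norm_le_const (a := (0 : ℝ)) (b := h)
      (f := fun r => F (Φ.flow r z)) (C := C) fun r _ => by
        simpa only [Real.norm_eq_abs] using hC (Φ.flow r z)
    simpa only [Real.norm_eq_abs, sub_zero, mul_comm C] using h1
  unfold windowAvg
  rw [abs_mul, abs_inv, abs_of_pos hh]
  calc h⁻¹ * |pathInt Φ F h z| ≤ h⁻¹ * (|h| * C) := mul_le_mul_of_nonneg_left hJ (inv_nonneg.2 hh.le)
    _ = C := by rw [abs_of_pos hh, ← mul_assoc, inv_mul_cancel₀ hh.ne', one_mul]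

/-- The window average of a measurable observable is `μ`-a.e. measurable for every law carried by the good
set (tree: `HardSphereFlow.aemeasurable_intervalIntegral_comp_flow_torus`; the path-integral form is
`Theorems.SelfTilt.aemeasurable_pathInt`). -/
theorem aemeasurable_windowAvg (Φ : TFlow ε n) {μ : Measure (TPhase n)} (hμ : μ Φ.goodᶜ = 0)
    {F : TPhase n → ℝ} (hF : Measurable F) (h : ℝ) : AEMeasurable (windowAvg Φ F h) μ :=
  (Φ.aemeasurable_intervalIntegral_comp_flow_torus hF 0 h hμ).const_mul _

end WindowAPI

/-! ### One-body law: total mass -/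

/-- The reduced coordinates are a continuous function of the configuration. -/
theorem continuous_reducedCoord (θ : ℝ) (u₀ : V3) (n : ℕ) (i : Fin n) :
    Continuous (reducedCoord θ u₀ n i) := by
  unfold reducedCoord
  fun_prop

/-- The reduced coordinates are a measurable function of the configuration. -/
theorem measurable_reducedCoord (θ : ℝ) (u₀ : V3) (n : ℕ) (i : Fin n) :
    Measurable (reducedCoord θ u₀ n i) :=
  (continuous_reducedCoord θ u₀ n i).measurable

/-- The reduced one-body law of a probability law is a probability law (`n ≥ 1`). -/
theorem isProbabilityMeasure_oneBodyLaw {ε : ℝ} {n : ℕ} (hn : n ≠ 0) (θ : ℝ) (u₀ : V3) (Φ : TFlow ε n)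
    (ν : Measure (TPhase n)) [IsProbabilityMeasure ν] (t : ℝ) :
    IsProbabilityMeasure (oneBodyLaw θ u₀ Φ ν t) := by
  constructor
  have hmap : ∀ i : Fin n,
      ν.map (fun z => reducedCoord θ u₀ n i (Φ.flow t z)) Set.univ = 1 := fun i => by
    rw [Measure.map_apply (f := fun z => reducedCoord θ u₀ n i (Φ.flow t z))
      ((measurable_reducedCoord θ u₀ n i).comp (Φ.measurable_flow t))
      MeasurableSet.univ, Set.preimage_univ, measure_univ]
  simp only [oneBodyLaw, Measure.smul_apply, Measure.coe_finsetSum, Finset.sum_apply, hmap,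
    Finset.sum_const, Finset.card_univ, Fintype.card_fin, nsmul_eq_mul, mul_one, smul_eq_mul]
  exact ENNReal.inv_mul_cancel (by exact_mod_cast hn) (ENNReal.natCast_ne_top n)

/-! ### Hellinger defect and production: elementary facts -/

/-- The Hellinger defect of a constant density vanishes (Maxwellians produce no entropy). -/
@[simp] theorem hellingerDefect_const (c : ℝ) (q : CollSpace) : hellingerDefect (fun _ => c) q = 0 := by
  simp [hellingerDefect]

/-- The production of a density that is constant in the velocity vanishes. -/
theorem production_eq_zero_of_const {ρ : T3 × V3 → ℝ} (hρ : ∀ x w w', ρ (x, w) = ρ (x, w')) :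
    production ρ = 0 := by
  have h : ∀ (x : T3) (q : CollSpace), hellingerDefect (fun w => ρ (x, w)) q = 0 := fun x q => by
    have := hellingerDefect_const (ρ (x, 0)) q
    simp only [hellingerDefect] at this ⊢
    rw [hρ x _ 0, hρ x (collide q.2 q.1).2 0, hρ x q.1.1 0, hρ x q.1.2 0]
    exact this
  simp [production, h]

/-! ### Bookkeeping sub-goal of the skeleton -/

/-- Statement of the bookkeeping sub-goal `stub_hTheoremObjects` (S0) — **the objects are junk-free where the
stub files use them first**: the window average of a bounded observable is bounded by the same constant, the
reduced one-body law of a probability law is a probability law, and a one-body density that is constant in the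
velocity (a global Maxwellian in reduced units) has zero Hellinger production. -/
def HTheoremObjectsBasic : Prop :=
  (∀ (ε : ℝ) (n : ℕ) (Φ : TFlow ε n) (F : TPhase n → ℝ) (C : ℝ), (∀ z, |F z| ≤ C) →
      ∀ h : ℝ, 0 < h → ∀ z, |windowAvg Φ F h z| ≤ C) ∧
    (∀ (ε : ℝ) (n : ℕ), n ≠ 0 → ∀ (θ : ℝ) (u₀ : V3) (Φ : TFlow ε n) (ν : Measure (TPhase n)),
      IsProbabilityMeasure ν → ∀ t : ℝ, IsProbabilityMeasure (oneBodyLaw θ u₀ Φ ν t)) ∧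
    ∀ ρ : T3 × V3 → ℝ, (∀ x w w', ρ (x, w) = ρ (x, w')) → production ρ = 0

/-- **Bookkeeping sub-goal S0** (`stub_hTheoremObjects`). -/
theorem stub_hTheoremObjects : HTheoremObjectsBasic :=
  ⟨fun _ _ Φ _ _ hC _ hh z => abs_windowAvg_le Φ hC hh z,
    fun _ _ hn θ u₀ Φ ν _ t => isProbabilityMeasure_oneBodyLaw hn θ u₀ Φ ν t,
    fun _ hρ => production_eq_zero_of_const hρ⟩

end Summit.AtomisticToContinuum.HydrodynamicLimit.Theorems.HTheorem

end
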